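import Summits.RiemannHypothesis.RiemannHypothesis.Theorems.PfPersistenceMirrorWindow
import Summits.RiemannHypothesis.RiemannHypothesis.Theorems.PfPersistenceGapClassG1
import HarnessLib

/-!
# PF persistence — arithmetic data form a LOEWNER ANTICHAIN; the coupling inhabitants (pub-rhpf, cand-6 gen 4)

**HONEST FRAMING. This is a long-odds MECHANISM SEARCH; no RH claims.** RH-free bookkeeping about the cell's
observatory records (truncated Weil matrices `datumOf w` of weight tables `w`); nothing here bears on the truth of
RH. PROVED = kernel-checked here or in the imported tree files.

* §1 ODD-HARMONIC WINDOWS (`thetaEven_diag_of_angle`): if `2π n y / L` is an odd multiple of `π` then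
  `θ_{nn}^{(L)}(y) = −(L − y)/L < 0 < (L − y)/L = θ_{00}^{(L)}(y)`: on the supports `L = 2ny/(2k−1)` the one-prime
  pattern at shift `y` is TWO-SIGNED on the basis vectors `e_0`, `e_n` (the mirror window is `n = k = 1`).
* §2 LOEWNER ANTICHAIN (`weights_eq_of_forall_form_le`): weight tables agreeing at the slots `0, 1` whose data are
  Loewner-comparable AT EVERY WINDOW are EQUAL (isolate the least differing slot `q₀` on `log q₀ ≤ 2a < log (q₀+1)`,
  where the difference is the single pattern `∓2 (w' q₀ − w q₀) θ^{(2a)}(log q₀)`, and read `e_0`, `e_{m+1}` at the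
  odd-harmonic support `2a = 2(m+1) log q₀/(2m+1)`). So `arithDialSpace` is an antichain: NO arithmetic datum other
  than `ζ` lies Loewner-above or -below `ζ`. No sign information about any datum is used.
* §3 THE CLOSED COUPLING CRITERION `S⁼ = {d | ζ ≤ d at every window}`: monotone, contains `ζ` TRIVIALLY, meets
  `arithDialSpace` only in `ζ` (so misses every arithmetic negative `≠ ζ`), not finitely determined, not uniformly
  robust at `ζ`. Hence (`monotone_barrier_schema_iff`) the schema "every monotone criterion containing `ζ` and missing
  the arithmetic negatives `≠ ζ` forces `AllWindowsPositive ζ`" is EQUIVALENT to `AllWindowsPositive ζ` (no RH-free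
  proof); and (`inter_diff_singleton_eq_of_complete_of_sound`) a `𝒫`-complete criterion missing the negatives `≠ ζ`
  of `D` COINCIDES WITH `𝒫` on `D ∖ {ζ}`: "strictly weaker than RH" is a property of a criterion's DESCRIPTION, which
  is why the cell's barrier theorems are (and must be) about READABILITY classes.
* §4 THE OPEN COUPLING TUBE `T_s = {d | ∀ w, d_w − ζ_w + s_w·1 ≻ 0}`, slack `s > 0` vanishing along heights: a member
  of the typed class `InG1cont` containing `ζ` TRIVIALLY and EXCLUDING EVERY declared dial — every `p`-dial `K ≠ 1`
  (heavy or light, up or down; read at the harmonic windows `a = (n+1) log p`) and every down-shift — with no sign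
  information (`exists_inG1cont_mem_zeta_excluding_dials`). So "`InG1cont S ∧ ζ ∈ S ∧ S` misses the dial battery" is
  INHABITED by a criterion whose `ζ`-membership is vacuous (coupling tier): "a surviving member is strictly weaker
  than RH" needs an axiom excluding such members (𝒫-completeness / obliviousness to `ζ`'s own record) to have
  content. A statement about the TYPE of admissible criteria — not a separation claim.
-/

set_option linter.dupNamespace false  -- the mandated namespace repeats `RiemannHypothesis`

open Real Finset Matrix Filter Topology

namespace Summit.RiemannHypothesis.RiemannHypothesis.Theorems.PfPersistence

/-! ## §1 Odd-harmonic windows: the one-prime pattern is two-signed on basis vectors -/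

/-- **PROVED — ODD-HARMONIC DIAGONAL VALUE:** if `2π n y / L = (2k+1) π` then `θ_{nn}^{(L)}(y) = −(L − y)/L`
(`cos (2k+1)π = −1`, `sin (2k+1)π = 0`). [folklore] -/
theorem thetaEven_diag_of_angle {L y : ℝ} {n : ℕ} (hn : n ≠ 0)
    (h : ∃ k : ℕ, 2 * π * n * y / L = ((2 * k + 1 : ℕ) : ℝ) * π) :
    thetaEven L n n y = -((L - y) / L) := by
  obtain ⟨k, hk⟩ := h
  have hcos : Real.cos (2 * π * n * y / L) = -1 := by
    rw [hk, Real.cos_nat_mul_pi]; exact Odd.neg_one_pow ⟨k, rfl⟩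
  have hsin : Real.sin (2 * π * n * y / L) = 0 := by rw [hk, Real.sin_nat_mul_pi]
  have hθ : thetaEven L n n y
      = (L - y) / L * Real.cos (2 * π * n * y / L) - Real.sin (2 * π * n * y / L) / (2 * π * n) := by
    simp [thetaEven, hn]
  rw [hθ, hcos, hsin]; ring

/-- PROVED: `θ_{00}^{(L)}(y) = (L − y)/L`. [folklore] -/
theorem thetaEven_zero_zero_apply (L y : ℝ) : thetaEven L 0 0 y = (L - y) / L :=
  congrFun (thetaEven_zero_zero L) y

/-- PROVED: on the harmonic support `L = 2 (n+1) y` (window `a = (n+1) y`) the angle of mode `n+1` is `π`. [folklore] -/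
theorem angle_harmonic {y : ℝ} (hy : y ≠ 0) (n : ℕ) :
    ∃ k : ℕ, 2 * π * ((n + 1 : ℕ) : ℝ) * y / (2 * (((n : ℝ) + 1) * y)) = ((2 * k + 1 : ℕ) : ℝ) * π :=
  ⟨0, by push_cast; field_simp⟩

/-- PROVED: on the near-threshold support `L = 2 (m+1) y / (2m+1)` the angle of mode `m+1` is `(2m+1) π`. [folklore] -/
theorem angle_nearThreshold {y : ℝ} (hy : y ≠ 0) (m : ℕ) :
    ∃ k : ℕ, 2 * π * ((m + 1 : ℕ) : ℝ) * y / (2 * (((m : ℝ) + 1) * y / (2 * (m : ℝ) + 1)))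
      = ((2 * k + 1 : ℕ) : ℝ) * π :=
  ⟨m, by push_cast; field_simp⟩

/-! ## §2 Single-slot differences and the Loewner antichain -/

/-- PROVED: if two weight tables agree on `primeRange L` except possibly at `q₀ ∈ primeRange L`, their prime parts
differ by the single term `2 (w' q₀ − w q₀) Θ(log q₀)`. [folklore] -/
theorem WP_sub_eq_single {L : ℝ} {w w' : Weights} {q₀ : ℕ} (hq₀ : q₀ ∈ primeRange L)
    (h : ∀ q ∈ primeRange L, q ≠ q₀ → w' q = w q) (Θ : ℝ → ℝ) :
    WP L w' Θ - WP L w Θ = 2 * ((w' q₀ - w q₀) * Θ (Real.log q₀)) := by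
  rw [WP, WP, ← mul_sub, ← Finset.sum_sub_distrib, Finset.sum_eq_single q₀
    (fun q hq hne => by rw [h q hq hne]; ring) (fun hq => absurd hq₀ hq)]
  ring

/-- PROVED: entrywise, the two data then differ by the single pattern `−2 (w' q₀ − w q₀) θ_{nm}(log q₀)`. [folklore] -/
theorem datumOf_sub_apply_of_single {w w' : Weights} {q₀ : ℕ} {win : Window}
    (hq₀ : q₀ ∈ primeRange (2 * win.a)) (h : ∀ q ∈ primeRange (2 * win.a), q ≠ q₀ → w' q = w q)
    (n m : Fin (win.N + 1)) :
    (datumOf w' win - datumOf w win) n m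
      = -(2 * ((w' q₀ - w q₀) * thetaEven (2 * win.a) n m (Real.log q₀))) := by
  have hWP := WP_sub_eq_single hq₀ h (thetaEven (2 * win.a) n m)
  simp only [Matrix.sub_apply, datumOf, evenBlock, weil]
  linear_combination (-1 : ℝ) * hWP

/-- **PROVED — THE LOEWNER ANTICHAIN (RH-free, sign-free).** Two weight tables that agree at the slots `0, 1` and
whose data are Loewner-comparable at EVERY window (`vᵀ d_w v ≤ vᵀ d'_w v` for all windows and vectors) are EQUAL. [folklore] -/
theorem weights_eq_of_forall_form_le {w w' : Weights} (h0 : w 0 = w' 0) (h1 : w 1 = w' 1)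
    (hle : ∀ win : Window, ∀ v : Fin (win.N + 1) → ℝ,
      v ⬝ᵥ (datumOf w win *ᵥ v) ≤ v ⬝ᵥ (datumOf w' win *ᵥ v)) : w = w' := by
  classical
  by_contra hne
  have hex : ∃ q, w q ≠ w' q := by
    by_contra hall; push Not at hall; exact hne (funext hall)
  set q₀ := Nat.find hex with hq₀def
  have hq₀ : w q₀ ≠ w' q₀ := Nat.find_spec hex
  have hmin : ∀ q, q < q₀ → w' q = w q := fun q hq => by
    have := Nat.find_min hex hq; push Not at this; exact this.symm
  have hq2 : 2 ≤ q₀ := by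
    have : q₀ ≠ 0 := fun h => hq₀ (by rw [h]; exact h0); have : q₀ ≠ 1 := fun h => hq₀ (by rw [h]; exact h1); omega
  have hq₀R : (2 : ℝ) ≤ q₀ := by exact_mod_cast hq2
  set y := Real.log q₀ with hy
  have hy0 : 0 < y := Real.log_pos (by linarith)
  set δ := Real.log ((q₀ : ℝ) + 1) - y with hδ
  have hδ0 : 0 < δ := by rw [hδ, hy]; exact sub_pos.2 (Real.log_lt_log (by linarith) (by linarith))
  obtain ⟨m, hm⟩ := exists_nat_gt (y / δ)
  have hden : (0 : ℝ) < 2 * (m : ℝ) + 1 := by positivity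
  -- the near-threshold odd-harmonic window `a = (m+1) y / (2m+1)`, `N = m+1`
  set a := ((m : ℝ) + 1) * y / (2 * (m : ℝ) + 1) with ha
  have ha0 : 0 < a := by positivity
  obtain ⟨win, hwa, hwN⟩ : ∃ win : Window, win.a = a ∧ win.N = m + 1 := ⟨⟨a, m + 1, ha0⟩, rfl, rfl⟩
  have h2a : 2 * win.a - y = y / (2 * (m : ℝ) + 1) := by rw [hwa, ha]; field_simp; ring
  have hgap0 : 0 < y / (2 * (m : ℝ) + 1) := by positivity
  have hyle : y ≤ 2 * win.a := by linarith
  have h2alt : 2 * win.a < Real.log ((q₀ : ℝ) + 1) := by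
    have hmy : y < δ * m := by have := (div_lt_iff₀ hδ0).1 hm; linarith
    have h3 : y / (2 * (m : ℝ) + 1) < δ := by rw [div_lt_iff₀ hden]; nlinarith
    linarith
  -- isolation: the window reaches `q₀` and nothing at or beyond `q₀ + 1`
  have hq₀mem : q₀ ∈ primeRange (2 * win.a) := mem_primeRange_of_log_le hyle
  have hiso : ∀ q ∈ primeRange (2 * win.a), q ≠ q₀ → w' q = w q := by
    intro q hq hqne
    have hqlt : q < q₀ + 1 := by
      by_contra hge; push Not at hge
      have hout : q ∉ primeRange (2 * win.a) := not_mem_primeRange_iff.2 (by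
        calc Real.exp (2 * win.a) < Real.exp (Real.log ((q₀ : ℝ) + 1)) := Real.exp_lt_exp.2 h2alt
          _ = (q₀ : ℝ) + 1 := Real.exp_log (by positivity)
          _ ≤ q := by exact_mod_cast hge)
      exact hout hq
    exact hmin q (by omega)
  -- the two readings `e_0` (θ₀₀ > 0) and `e_{m+1}` (θ = −θ₀₀ < 0)
  have hθpos : 0 < (2 * win.a - y) / (2 * win.a) := by apply div_pos <;> linarith
  have hdiff : ∀ v, 0 ≤ v ⬝ᵥ ((datumOf w' win - datumOf w win) *ᵥ v) := fun v => by
    rw [Matrix.sub_mulVec, dotProduct_sub]; exact sub_nonneg.2 (hle win v)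
  have e0 := hdiff (Pi.single 0 1)
  rw [single_form_single, datumOf_sub_apply_of_single hq₀mem hiso, Fin.val_zero,
    thetaEven_zero_zero_apply] at e0
  let i : Fin (win.N + 1) := ⟨m + 1, by omega⟩
  have eN := hdiff (Pi.single i 1)
  rw [single_form_single, datumOf_sub_apply_of_single hq₀mem hiso] at eN
  have hθN : thetaEven (2 * win.a) (i : ℕ) (i : ℕ) (Real.log q₀) = -((2 * win.a - y) / (2 * win.a)) := by
    have hang := angle_nearThreshold hy0.ne' m
    rw [← ha, ← hwa] at hang
    exact thetaEven_diag_of_angle (Nat.succ_ne_zero m) hang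
  rw [hθN] at eN
  have hle0 : (w' q₀ - w q₀) * ((2 * win.a - y) / (2 * win.a)) ≤ 0 := by linarith
  have hge0 : 0 ≤ (w' q₀ - w q₀) * ((2 * win.a - y) / (2 * win.a)) := by linarith
  rcases mul_eq_zero.1 (le_antisymm hle0 hge0) with h | h
  · exact hq₀ (by linarith)
  · exact hθpos.ne' h

/-- **PROVED — datum form:** origin-free data that are Loewner-comparable at every window are EQUAL. [folklore] -/
theorem eq_of_forall_form_le_of_mem_originFree {d d' : Datum} (hd : d ∈ originFreeDialSpace)
    (hd' : d' ∈ originFreeDialSpace)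
    (hle : ∀ win : Window, ∀ v : Fin (win.N + 1) → ℝ, v ⬝ᵥ (d win *ᵥ v) ≤ v ⬝ᵥ (d' win *ᵥ v)) : d = d' := by
  obtain ⟨w, hw, rfl⟩ := hd
  obtain ⟨w', hw', rfl⟩ := hd'
  rw [weights_eq_of_forall_form_le (hw.1.trans hw'.1.symm) (hw.2.trans hw'.2.symm) hle]

/-- PROVED: the same on the arithmetic dial space. [folklore] -/
theorem eq_of_forall_form_le_of_mem_arith {d d' : Datum} (hd : d ∈ arithDialSpace) (hd' : d' ∈ arithDialSpace)
    (hle : ∀ win : Window, ∀ v : Fin (win.N + 1) → ℝ, v ⬝ᵥ (d win *ᵥ v) ≤ v ⬝ᵥ (d' win *ᵥ v)) : d = d' :=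
  eq_of_forall_form_le_of_mem_originFree (arithDialSpace_subset_originFreeDialSpace hd)
    (arithDialSpace_subset_originFreeDialSpace hd') hle

/-! ## §3 The closed coupling criterion `S⁼ = {d | ζ ≤ d}` and the monotone barrier schema -/

/-- PROVED: `ζ ∈ S⁼`, trivially (no positivity input). [folklore] -/
theorem zeta_mem_loewnerAbove :
    zetaDatum ∈ {d : Datum | ∀ win : Window, ∀ v : Fin (win.N + 1) → ℝ,
      v ⬝ᵥ (zetaDatum win *ᵥ v) ≤ v ⬝ᵥ (d win *ᵥ v)} :=
  fun _ _ => le_rfl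

/-- PROVED: `S⁼` is MONOTONE (an upper set for the window-wise Loewner order). [folklore] -/
theorem loewnerAbove_monotone {d d' : Datum}
    (hd : ∀ win : Window, ∀ v : Fin (win.N + 1) → ℝ, v ⬝ᵥ (zetaDatum win *ᵥ v) ≤ v ⬝ᵥ (d win *ᵥ v))
    (hle : ∀ win : Window, ∀ v : Fin (win.N + 1) → ℝ, v ⬝ᵥ (d win *ᵥ v) ≤ v ⬝ᵥ (d' win *ᵥ v)) :
    ∀ win : Window, ∀ v : Fin (win.N + 1) → ℝ, v ⬝ᵥ (zetaDatum win *ᵥ v) ≤ v ⬝ᵥ (d' win *ᵥ v) :=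
  fun win v => (hd win v).trans (hle win v)

/-- **PROVED — `S⁼` MEETS THE ARITHMETIC DIAL SPACE ONLY IN `ζ`** (no arithmetic datum `≠ ζ` is Loewner-above `ζ`;
nor below, by swapping arguments): it misses every arithmetic negative `≠ ζ`, by the antichain, with no sign input. [folklore] -/
theorem loewnerAbove_inter_arith {d : Datum} (hd : d ∈ arithDialSpace)
    (hmem : d ∈ {d : Datum | ∀ win : Window, ∀ v : Fin (win.N + 1) → ℝ,
      v ⬝ᵥ (zetaDatum win *ᵥ v) ≤ v ⬝ᵥ (d win *ᵥ v)}) : d = zetaDatum :=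
  (eq_of_forall_form_le_of_mem_arith zetaDatum_mem_arithDialSpace hd hmem).symm

/-- PROVED: `S⁼` is NOT finitely determined (wall W1 would put a heavy arithmetic dial `≠ ζ` in it). [folklore] -/
theorem loewnerAbove_not_finitelyDetermined :
    ¬ FinitelyDetermined {d : Datum | ∀ win : Window, ∀ v : Fin (win.N + 1) → ℝ,
      v ⬝ᵥ (zetaDatum win *ᵥ v) ≤ v ⬝ᵥ (d win *ᵥ v)} := fun hS => by
  obtain ⟨d, hdD, hne, hdS, -⟩ := finitelyDetermined_meets_arithDialNegativesNe hS zeta_mem_loewnerAbove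
  exact hne (loewnerAbove_inter_arith hdD hdS)

/-- PROVED: `S⁼` is NOT uniformly robust at `ζ` (W2's hypothesis fails): small `2`-dials are uniformly close
(`dial_form_abs_le`) and lie outside `S⁼` WHATEVER their sign. [folklore] -/
theorem loewnerAbove_not_uniformlyRobustAt :
    ¬ UniformlyRobustAt {d : Datum | ∀ win : Window, ∀ v : Fin (win.N + 1) → ℝ,
      v ⬝ᵥ (zetaDatum win *ᵥ v) ≤ v ⬝ᵥ (d win *ᵥ v)} zetaDatum := by
  rintro ⟨ε, hε, hrob⟩
  have hw2 : 0 < zetaWeights 2 := zetaWeights_pos_of_prime Nat.prime_two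
  set K : ℝ := 1 + ε / (2 * (zetaWeights 2 + 1)) with hK
  have hK1 : K - 1 = ε / (2 * (zetaWeights 2 + 1)) := by rw [hK]; ring
  have hKpos : 0 < K - 1 := by rw [hK1]; positivity
  have hcoef : 2 * |K - 1| * |zetaWeights 2| ≤ ε := by
    rw [abs_of_pos hKpos, abs_of_pos hw2, hK1,
      show 2 * (ε / (2 * (zetaWeights 2 + 1))) * zetaWeights 2 = ε * (zetaWeights 2 / (zetaWeights 2 + 1)) by
        field_simp]
    have : zetaWeights 2 / (zetaWeights 2 + 1) ≤ 1 := by rw [div_le_one (by linarith)]; linarith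
    nlinarith
  have hclose : UniformlyClose ε zetaDatum (datumOf (dial 2 K zetaWeights)) := fun win v => by
    rw [Matrix.sub_mulVec, dotProduct_sub]
    exact (dial_form_abs_le win.ha 2 K zetaWeights v).trans
      (mul_le_mul_of_nonneg_right hcoef (dotProduct_self_nonneg_real v))
  have hmem := hrob _ hclose
  exact datumOf_dial_ne le_rfl (ne_of_gt (by linarith)) hw2.ne'
    (loewnerAbove_inter_arith (datumOf_dial_zeta_mem_arithDialSpace 2 K) hmem)

/-- **PROVED — THE MONOTONE BARRIER SCHEMA IS ITSELF OF RH-STRENGTH.** "Every monotone criterion containing `ζ` and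
missing the arithmetic negatives `≠ ζ` forces Galerkin Weil positivity of `ζ`" is EQUIVALENT to that positivity
(witness `S⁼`): no RH-free barrier of this shape exists for monotone / convex-acceptance ALL-WINDOW criteria. [folklore] -/
theorem monotone_barrier_schema_iff :
    (∀ S : Set Datum,
        (∀ d d' : Datum, d ∈ S →
          (∀ win : Window, ∀ v : Fin (win.N + 1) → ℝ, v ⬝ᵥ (d win *ᵥ v) ≤ v ⬝ᵥ (d' win *ᵥ v)) → d' ∈ S) →
        zetaDatum ∈ S →
        (∀ d ∈ arithDialSpace, d ≠ zetaDatum → DetectablyNegative d → d ∉ S) →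
        AllWindowsPositive zetaDatum)
      ↔ AllWindowsPositive zetaDatum :=
  ⟨fun h => h _ (fun _ _ hd hle => loewnerAbove_monotone hd hle) zeta_mem_loewnerAbove
      fun _ hd hne _ hmem => hne (loewnerAbove_inter_arith hd hmem),
    fun h _ _ _ _ => h⟩

/-- **PROVED — EXTENSIONAL COLLAPSE:** a `𝒫`-complete criterion (`𝒫 ∩ D ⊆ S`) missing the negatives `≠ d₀` of `D`
coincides with `𝒫` on `D ∖ {d₀}`: sound-and-complete criteria differ from positivity at most at the point `d₀`; only
the DESCRIPTION under which `d₀ ∈ S` is verified can be "weaker than RH" (`𝒫 ∪ S⁼` shows `d₀ = ζ` stays free). [folklore] -/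
theorem inter_diff_singleton_eq_of_complete_of_sound {S D : Set Datum} {d₀ : Datum}
    (hcomplete : positiveClass ∩ D ⊆ S) (hsound : ∀ d ∈ D, d ≠ d₀ → DetectablyNegative d → d ∉ S) :
    S ∩ (D \ {d₀}) = positiveClass ∩ (D \ {d₀}) := by
  ext d
  simp only [Set.mem_inter_iff, Set.mem_sdiff, Set.mem_singleton_iff]
  constructor
  · rintro ⟨hdS, hdD, hne⟩
    refine ⟨?_, hdD, hne⟩
    by_contra hpos
    exact hsound d hdD hne ((detectablyNegative_iff_not_allWindowsPositive d).2 hpos) hdS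
  · rintro ⟨hdP, hdD, hne⟩
    exact ⟨hcomplete ⟨hdP, hdD⟩, hdD, hne⟩

/-! ## §4 The open coupling tube: a typed `G1-cont` member defeating the whole dial battery, vacuously -/

/-- PROVED: `ζ` lies in the tube `T_s` for every positive slack `s` — trivially. [folklore] -/
theorem zeta_mem_tube {s : Window → ℝ} (hs : ∀ win, 0 < s win) :
    zetaDatum ∈ {d : Datum | ∀ win : Window, WindowStrictlyPositive
      (d win - zetaDatum win + s win • (1 : Matrix (Fin (win.N + 1)) (Fin (win.N + 1)) ℝ))} := by
  intro win v hv
  rw [sub_self, zero_add, Matrix.smul_mulVec, Matrix.one_mulVec, dotProduct_smul, smul_eq_mul]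
  exact mul_pos (hs win)
    (lt_of_le_of_ne (dotProduct_self_nonneg_real v) fun h => hv (dotProduct_self_eq_zero.1 h.symm))

/-- PROVED: the tube is WINDOW-WISE OPEN (clause (1) of G1-cont). [folklore] -/
theorem isWindowwiseOpen_tube (s : Window → ℝ) :
    IsWindowwiseOpen {d : Datum | ∀ win : Window, WindowStrictlyPositive
      (d win - zetaDatum win + s win • (1 : Matrix (Fin (win.N + 1)) (Fin (win.N + 1)) ℝ))} :=
  ⟨fun win => {M | WindowStrictlyPositive
      (M - zetaDatum win + s win • (1 : Matrix (Fin (win.N + 1)) (Fin (win.N + 1)) ℝ))},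
    fun _ => (isOpen_setOf_windowStrictlyPositive _).preimage
      ((continuous_id.sub continuous_const).add continuous_const), rfl⟩

/-- PROVED: the tube is NON-LOCAL AT EVERY HEIGHT (clause (2): push `ζ` down by the slack at one high window). [folklore] -/
theorem nonlocalAtEveryHeight_tube {s : Window → ℝ} (hs : ∀ win, 0 < s win) :
    NonlocalAtEveryHeight {d : Datum | ∀ win : Window, WindowStrictlyPositive
      (d win - zetaDatum win + s win • (1 : Matrix (Fin (win.N + 1)) (Fin (win.N + 1)) ℝ))} := by
  classical
  intro A
  refine not_determinedOn_of_exit (zeta_mem_tube hs) ?_ (windowAbove_not_mem_below A)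
    (d := Function.update zetaDatum (windowAbove A)
      (zetaDatum (windowAbove A) - s (windowAbove A) • (1 : Matrix _ _ ℝ))) fun win hwin => by simp [hwin]
  intro hd
  have h := hd (windowAbove A) (Pi.single 0 1) (fun h => by simpa using congrFun h 0)
  simp at h

/-- **PROVED — MEMBERSHIP CERTIFICATE:** the tube is a member of the typed class `G1-cont`. [folklore] -/
theorem inG1cont_tube {s : Window → ℝ} (hs : ∀ win, 0 < s win) :
    InG1cont {d : Datum | ∀ win : Window, WindowStrictlyPositive
      (d win - zetaDatum win + s win • (1 : Matrix (Fin (win.N + 1)) (Fin (win.N + 1)) ℝ))} :=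
  inG1cont_of (isWindowwiseOpen_tube s) (nonlocalAtEveryHeight_tube hs)

/-- **PROVED — THE TUBE REJECTS A `p`-DIAL AT A HARMONIC WINDOW** `a = (n+1) log p`, `N ≥ n+1`, slack
`≤ |K−1| |w(p)|`: the difference to `ζ` is the single pattern `−2(K−1) w(p) θ(log p)`, two-signed on `e_0`, `e_{n+1}`
with modulus `≥ |K−1| |w(p)|`. No sign of the dial is used. [folklore] -/
theorem pDial_not_mem_tube {s : Window → ℝ} {p : ℕ} (hp : 2 ≤ p) {K : ℝ} (hK : (K - 1) * zetaWeights p ≠ 0)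
    {win : Window} {n : ℕ} (hwa : win.a = ((n : ℝ) + 1) * Real.log p) (hwN : n + 1 ≤ win.N)
    (hsw : s win ≤ |K - 1| * |zetaWeights p|) :
    pDial p K ∉ {d : Datum | ∀ win : Window, WindowStrictlyPositive
      (d win - zetaDatum win + s win • (1 : Matrix (Fin (win.N + 1)) (Fin (win.N + 1)) ℝ))} := by
  intro hd
  have hlogp : 0 < Real.log p := Real.log_pos (by exact_mod_cast (by omega : 1 < p))
  have hyle : Real.log p ≤ 2 * win.a := by rw [hwa]; nlinarith
  have hmem : p ∈ primeRange (2 * win.a) := mem_primeRange_of_log_le hyle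
  have hmat : pDial p K win - zetaDatum win + s win • (1 : Matrix (Fin (win.N + 1)) (Fin (win.N + 1)) ℝ)
      = s win • (1 : Matrix _ _ ℝ) - (2 * (K - 1) * zetaWeights p) • primePattern p win := by
    rw [pDial_apply_of_mem hmem]; abel
  have hform : ∀ i : Fin (win.N + 1),
      (Pi.single i 1 : Fin (win.N + 1) → ℝ) ⬝ᵥ ((pDial p K win - zetaDatum win + s win • (1 : Matrix _ _ ℝ))
        *ᵥ Pi.single i 1) = s win - 2 * (K - 1) * zetaWeights p * thetaEven (2 * win.a) i i (Real.log p) := by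
    intro i
    rw [hmat, single_form_single]
    simp [Matrix.sub_apply, Matrix.smul_apply, primePattern]
  have hθge : 1 / 2 ≤ (2 * win.a - Real.log p) / (2 * win.a) := by
    rw [hwa, le_div_iff₀ (mul_pos two_pos (mul_pos (by positivity) hlogp))]
    nlinarith [(Nat.cast_nonneg n : (0 : ℝ) ≤ n)]
  have hθ0 : thetaEven (2 * win.a) ((0 : Fin (win.N + 1)) : ℕ) ((0 : Fin (win.N + 1)) : ℕ) (Real.log p)
      = (2 * win.a - Real.log p) / (2 * win.a) := by rw [Fin.val_zero, thetaEven_zero_zero_apply]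
  let i : Fin (win.N + 1) := ⟨n + 1, by omega⟩
  have hθN : thetaEven (2 * win.a) (i : ℕ) (i : ℕ) (Real.log p) = -((2 * win.a - Real.log p) / (2 * win.a)) := by
    have hang := angle_harmonic hlogp.ne' n
    rw [← hwa] at hang
    exact thetaEven_diag_of_angle (Nat.succ_ne_zero n) hang
  have habs : |2 * (K - 1) * zetaWeights p| = 2 * (|K - 1| * |zetaWeights p|) := by
    rw [abs_mul, abs_mul, abs_two, mul_assoc]
  rcases lt_or_gt_of_ne hK with hneg | hpos
  · -- `(K−1) w(p) < 0`: read mode `n+1`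
    have h := hd win (Pi.single i 1) (fun h => by simpa using congrFun h i)
    rw [hform i, hθN] at h
    have hcabs : |2 * (K - 1) * zetaWeights p| = -(2 * (K - 1) * zetaWeights p) := abs_of_neg (by linarith)
    nlinarith
  · -- `(K−1) w(p) > 0`: read mode `0`
    have h := hd win (Pi.single 0 1) (fun h => by simpa using congrFun h 0)
    rw [hform 0, hθ0] at h
    have hcabs : |2 * (K - 1) * zetaWeights p| = 2 * (K - 1) * zetaWeights p := abs_of_pos (by linarith)
    nlinarith

/-- **PROVED — THE TUBE EXCLUDES EVERY PRIME DIAL** `K ≠ 1` (heavy or light, up or down) when the slack vanishes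
along heights — RH-free and sign-free. [folklore] -/
theorem pDial_not_mem_tube_of_vanishing {s : Window → ℝ}
    (hs0 : ∀ ε : ℝ, 0 < ε → ∃ A : ℝ, ∀ win : Window, A ≤ win.a → s win ≤ ε)
    {p : ℕ} (hp : p.Prime) {K : ℝ} (hK : K ≠ 1) :
    pDial p K ∉ {d : Datum | ∀ win : Window, WindowStrictlyPositive
      (d win - zetaDatum win + s win • (1 : Matrix (Fin (win.N + 1)) (Fin (win.N + 1)) ℝ))} := by
  have hw : 0 < zetaWeights p := zetaWeights_pos_of_prime hp
  have hK1 : 0 < |K - 1| := abs_pos.2 (sub_ne_zero.2 hK)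
  obtain ⟨A, hA⟩ := hs0 (|K - 1| * |zetaWeights p|) (mul_pos hK1 (abs_pos.2 hw.ne'))
  have hlogp : 0 < Real.log p := Real.log_pos (by exact_mod_cast hp.one_lt)
  obtain ⟨n, hn⟩ := exists_nat_ge (A / Real.log p)
  have ha0 : 0 < ((n : ℝ) + 1) * Real.log p := by positivity
  have hAle : A ≤ ((n : ℝ) + 1) * Real.log p := by
    have := (div_le_iff₀ hlogp).1 hn; nlinarith
  exact pDial_not_mem_tube hp.two_le (mul_ne_zero (sub_ne_zero.2 hK) hw.ne')
    (win := ⟨((n : ℝ) + 1) * Real.log p, n + 1, ha0⟩) rfl le_rfl (hA _ hAle)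

/-- PROVED: the tube excludes every DOWN-SHIFT `ζ − δ·1`, `δ > 0`, when the slack vanishes along heights. [folklore] -/
theorem shiftDial_not_mem_tube_of_vanishing {s : Window → ℝ}
    (hs0 : ∀ ε : ℝ, 0 < ε → ∃ A : ℝ, ∀ win : Window, A ≤ win.a → s win ≤ ε) {δ : ℝ} (hδ : 0 < δ) :
    shiftDial δ ∉ {d : Datum | ∀ win : Window, WindowStrictlyPositive
      (d win - zetaDatum win + s win • (1 : Matrix (Fin (win.N + 1)) (Fin (win.N + 1)) ℝ))} := by
  intro hd
  obtain ⟨A, hA⟩ := hs0 δ hδ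
  have hAle : A ≤ (windowAbove A).a := ((le_max_left A 0).trans (lt_add_one _).le)
  have h := hd (windowAbove A) (Pi.single 0 1) (fun h => by simpa using congrFun h 0)
  have hmat : shiftDial δ (windowAbove A) - zetaDatum (windowAbove A)
      + s (windowAbove A) • (1 : Matrix (Fin ((windowAbove A).N + 1)) (Fin ((windowAbove A).N + 1)) ℝ)
      = (s (windowAbove A) - δ) • (1 : Matrix _ _ ℝ) := by
    rw [shiftDial, shift, sub_smul]; abel
  rw [hmat, Matrix.smul_mulVec, Matrix.one_mulVec, dotProduct_smul, smul_eq_mul] at h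
  have hvv : (Pi.single 0 1 : Fin ((windowAbove A).N + 1) → ℝ) ⬝ᵥ Pi.single 0 1 = 1 := by simp
  rw [hvv, mul_one] at h
  linarith [hA _ hAle]

/-- **PROVED — THE COUPLING INHABITANT OF G1-cont (RH-free, sign-free).** Some criterion of the typed class `G1-cont`
contains `ζ` and excludes EVERY declared dial of clause (3) — all prime dials `K ≠ 1`, all down-shifts — namely the tube
with slack `s_w = 1/(a_w + 1)`, whose `ζ`-membership is VACUOUS (coupling tier). So the conjunction "G1-cont ∧ `ζ ∈ S` ∧
misses the dial battery" carries no information about `ζ`; "a surviving member is strictly weaker than RH" needs an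
axiom excluding coupling members (e.g. `𝒫`-completeness, cf. `inter_diff_singleton_eq_of_complete_of_sound`). [folklore] -/
theorem exists_inG1cont_mem_zeta_excluding_dials :
    ∃ S : Set Datum, InG1cont S ∧ zetaDatum ∈ S ∧
      (∀ p : ℕ, p.Prime → ∀ K : ℝ, K ≠ 1 → pDial p K ∉ S) ∧ (∀ δ : ℝ, 0 < δ → shiftDial δ ∉ S) := by
  set s : Window → ℝ := fun win => 1 / (win.a + 1) with hs
  have hspos : ∀ win, 0 < s win := fun win => by have := win.ha; rw [hs]; positivity
  have hs0 : ∀ ε : ℝ, 0 < ε → ∃ A : ℝ, ∀ win : Window, A ≤ win.a → s win ≤ ε := by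
    refine fun ε hε => ⟨1 / ε, fun win hwin => ?_⟩
    have ha := win.ha
    rw [hs, show (fun win : Window => 1 / (win.a + 1)) win = 1 / (win.a + 1) from rfl,
      div_le_iff₀ (by positivity)]
    have := (div_le_iff₀ hε).1 hwin; nlinarith
  exact ⟨_, inG1cont_tube hspos, zeta_mem_tube hspos,
    fun p hp K hK => pDial_not_mem_tube_of_vanishing hs0 hp hK,
    fun δ hδ => shiftDial_not_mem_tube_of_vanishing hs0 hδ⟩

end Summit.RiemannHypothesis.RiemannHypothesis.Theorems.PfPersistence
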